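import Summits.PneNP.PneNP.Theorems.SymmetryBudgetNoHiddenOrderFLabCard

/-!
# `NoHiddenOrder` (stmt-PneNP-14781), (R2c) VI support: `ofLab` / `toLab` round trips and equivariance

Route `PneNP/SymmetryBudget`; continues `…FLabCard.lean` (namespace `WCanon` of `…ProgramGates.lean`).  The program reads the groups of part /
candidate labels through `ofLab : Label (WV m) → Option (FLab m)`; its symmetry bookkeeping needs that `ofLab` intertwines the relabelling actions
and inverts `toLab`:

* `ofLab_toLab : ofLab (toLab F) = some F`, `toLab_ofLab : ofLab L = some F → toLab F = L`, `ofLab_eq_some_iff`;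
* **`ofLab_relabel : ofLab (L.relabel σ) = (ofLab L).map (FLab.relabel σ)`** — so `ofLab ((toLab F).part U')` / `ofLab ((toLab F).cand x v)` transform
  under `σ` exactly as the gate indices do (`relabel_part`, `relabel_cand` of `…WindowLabelsSym.lean`, `toLab_relabel` of `…FLabCard.lean`).
Sorry-free; supports stmt-PneNP-14781, does not close it.
-/

set_option linter.dupNamespace false -- `Summit.PneNP.PneNP.…` (D-0017 single-conjunct layout)

namespace Summit.PneNP.PneNP.Theorems

open Finset BranchSum

namespace WCanon

variable {m : ℕ}

/-- The admissibility test of `ofLab`. [folklore] -/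
theorem ofLab_eq_dite (L : CertifiedLabels.Label (WV m)) [Decidable ((∀ v, L.lam v < wn m) ∧ AdmB (Bw m) L.X L.lam)] :
    ofLab L = if h : (∀ v, L.lam v < wn m) ∧ AdmB (Bw m) L.X L.lam then some ⟨(L.U, L.X, fun v => ⟨L.lam v, h.1 v⟩), h.2⟩ else none := by
  unfold ofLab
  congr

/-- **`ofLab` recognises exactly the admissible labels**: `ofLab L = some F ↔ (λ < wn ∧ AdmB) ∧ toLab F = L`. [folklore] -/
theorem ofLab_eq_some_iff (L : CertifiedLabels.Label (WV m)) (F : FLab m) :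
    ofLab L = some F ↔ ((∀ v, L.lam v < wn m) ∧ AdmB (Bw m) L.X L.lam) ∧ toLab F = L := by
  classical
  rw [ofLab_eq_dite]
  by_cases h : (∀ v, L.lam v < wn m) ∧ AdmB (Bw m) L.X L.lam
  · rw [dif_pos h, Option.some.injEq]
    constructor
    · rintro rfl
      exact ⟨h, rfl⟩
    · rintro ⟨-, hF⟩
      obtain ⟨⟨U, X, lam⟩, hL⟩ := F
      subst hF
      rfl
  · rw [dif_neg h]
    simp only [reduceCtorEq, false_iff, not_and]
    exact fun h' _ => (h h').elim

/-- `ofLab` inverts `toLab`. [folklore] -/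
theorem ofLab_toLab (F : FLab m) : ofLab (toLab F) = some F :=
  (ofLab_eq_some_iff _ F).2 ⟨⟨fun v => (F.1.2.2 v).is_lt, F.2⟩, rfl⟩

/-- A recognised label is the denotation of the recognised admissible label. [folklore] -/
theorem toLab_ofLab {L : CertifiedLabels.Label (WV m)} {F : FLab m} (h : ofLab L = some F) : toLab F = L :=
  ((ofLab_eq_some_iff L F).1 h).2

/-- `ofLab L = none` iff `L` is not admissible (`λ ≥ wn` somewhere, or not `AdmB`). [folklore] -/
theorem ofLab_eq_none_iff (L : CertifiedLabels.Label (WV m)) : ofLab L = none ↔ ¬ ((∀ v, L.lam v < wn m) ∧ AdmB (Bw m) L.X L.lam) := by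
  classical
  rw [ofLab_eq_dite]
  by_cases h : (∀ v, L.lam v < wn m) ∧ AdmB (Bw m) L.X L.lam
  · rw [dif_pos h]
    simp only [reduceCtorEq, false_iff, not_not]
    exact h
  · rw [dif_neg h]
    simp only [true_iff]
    exact h

/-- The admissibility test is invariant under relabelling. [folklore] -/
theorem adm_relabel_iff (σ : Equiv.Perm (WV m)) (L : CertifiedLabels.Label (WV m)) :
    ((∀ v, (L.relabel σ).lam v < wn m) ∧ AdmB (Bw m) (L.relabel σ).X (L.relabel σ).lam) ↔ ((∀ v, L.lam v < wn m) ∧ AdmB (Bw m) L.X L.lam) := by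
  rw [admB_relabel_label]
  refine and_congr_left fun _ => ⟨fun h v => ?_, fun h v => h _⟩
  simpa using h (σ v)

/-- **`ofLab` intertwines the relabelling actions**: `ofLab (σ · L) = (ofLab L).map (σ · _)`. [folklore] -/
theorem ofLab_relabel (σ : Equiv.Perm (WV m)) (L : CertifiedLabels.Label (WV m)) :
    ofLab (L.relabel σ) = (ofLab L).map (FLab.relabel σ) := by
  rcases hL : ofLab L with _ | F
  · rw [Option.map_none, ofLab_eq_none_iff, adm_relabel_iff, ← ofLab_eq_none_iff]
    exact hL
  · rw [Option.map_some, ofLab_eq_some_iff]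
    obtain ⟨hadm, hF⟩ := (ofLab_eq_some_iff L F).1 hL
    refine ⟨(adm_relabel_iff σ L).2 hadm, ?_⟩
    rw [toLab_relabel, hF]

/-- In particular for part labels: `ofLab ((σ · L).part (σ U')) = (ofLab (L.part U')).map (σ · _)`. [folklore] -/
theorem ofLab_part_relabel (σ : Equiv.Perm (WV m)) (L : CertifiedLabels.Label (WV m)) (U' : Finset (WV m)) :
    ofLab ((L.relabel σ).part (U'.map σ.toEmbedding)) = (ofLab (L.part U')).map (FLab.relabel σ) := by
  rw [← CertifiedLabels.Label.relabel_part, ofLab_relabel]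

/-- In particular for candidate labels: `ofLab ((σ · L).cand (σ x) v) = (ofLab (L.cand x v)).map (σ · _)`. [folklore] -/
theorem ofLab_cand_relabel (σ : Equiv.Perm (WV m)) (L : CertifiedLabels.Label (WV m)) (x : WV m) (v : ℕ) :
    ofLab ((L.relabel σ).cand (σ x) v) = (ofLab (L.cand x v)).map (FLab.relabel σ) := by
  rw [← CertifiedLabels.Label.relabel_cand, ofLab_relabel]

end WCanon

end Summit.PneNP.PneNP.Theorems
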